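import Literature.Analysis.FluidPDE.PassiveVectorTensorPropagatorBandKill
import Literature.Analysis.FluidPDE.PassiveVectorTensorPropagatorEnergy
import Literature.Analysis.FluidPDE.PassiveVectorTensorSymmetry
import HarnessLib

/-!
# BLOCH-SECTOR CONFINEMENT OF THE WINDOW PROPAGATOR AT EVERY TIME: along a carrier invariant under finitely many
# translations, `U s t y` keeps its Fourier support in the multiplier level set of the datum

Analysis/FluidPDE proof file (everything proved; no definitions, no named facts).  `PassiveVectorTensorSymmetry` proves, for EVERY weak
solution of the tensor passive-vector problem along a carrier `b` invariant under finitely many translations `gᵢ` of `T^d`, that the Fourier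
support stays (for a.e. time) inside the level set `{k : ĉ(k) = m}` (`m ≠ 0`) of the real multiplier `ĉ(k) = Σᵢ cᵢ e_k(gᵢ)` containing the
support of the datum (`IsWeakTensorPassiveVectorOn.ae_mFourierCoeff_eq_zero_of_multiplier'`).  This file lifts the statement to the
two-parameter solution PROPAGATOR `U` (`Torus.IsPropagator`) at EVERY pair of times `0 ≤ s ≤ t ≤ T`:

* `IsPropagator.mFourierCoeff_apply_eq_zero_of_multiplier` — if `𝓕y` is supported in `{ĉ = m}`, then `𝓕(U s t y)(k) = 0` whenever
  `ĉ(k) ≠ m`.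

Proof: the Leray projection is a modewise contraction (`norm_mFourierCoeff_starProjection_le`), so `P_σ y` has the same support and
`U s s y = P_σ y`; for `s < t` the chosen window solution from `P_σ y` is confined for a.e. window time, `IsPropagator.repr` identifies it with
`U s (s+τ) y` for a.e. `τ`, and the value AT `t` is reached through the weak continuity `IsPropagator.continuousOn` tested against the real
trigonometric polynomial carrying the two coefficients `𝓕(U s t y)(±k)` (`integral_inner_realTrigPoly_right`; the a.e.-zero continuous pairing
vanishes at the endpoint, `le_on_Icc_of_ae_le_of_continuousOn₂`), exactly as in `PassiveVectorTensorPropagatorBandKill` (i).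
Consumer: cell `ad-ideate`, K1L_D `stmt-AnomalousDissipation-27980`, the (ℓ2) flat blocks of `stub_Vmod_of_VRH` — class diagonalisation
(R-b) of the certifier's regime table: along the `(1/n)`-periodic cell field the propagator preserves every symmetric Bloch class pair
`{k ≡ ±κ (mod n)}`, so the four block pairings and the two losses split over the `n^d` class pairs.

## Mathlib / tree search
Tree: `PassiveVectorTensorSymmetry` (`ae_mFourierCoeff_eq_zero_of_multiplier'`), `PassiveVectorTensorPropagator` (`windowSol`,
`IsPropagator.repr`, `isWeaklyDivFree_starProjection`), `PassiveVectorTensorPropagatorUnique.apply_eq_apply_starProjection`,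
`PassiveVectorTensorPropagatorEnergy.le_on_Icc_of_ae_le_of_continuousOn₂`, `PassiveVectorTensorPropagatorBandKill`
(`memLp_top_stLift_shift_window`; the endpoint technique of (i)), `DivFreeProjectionFourier.norm_mFourierCoeff_starProjection_le`,
`TorusTrigPoly` (`realTrigPoly`, `integral_inner_realTrigPoly_right`, `memLp_realTrigPoly`), `TorusVectorParseval.mFourierCoeff_congr_ae`.
Mathlib: `UnitAddTorus.mFourier_neg`, `MeasureTheory.L2.inner_def`.  No every-time sector statement for the propagator existed (2026-08-29).

## References
* M. Kha, P. Kuchment, arXiv:2007.02832 (2021), §1.1–§1.2 (periodic operators commute with the lattice action; Bloch sectors).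
  [`KhaKuchment2021`]
* R. Temam, *Navier–Stokes Equations*, 3rd ed. (North-Holland 1984), Ch. III §1, Lemma 1.4 (weak continuity in time). [`Temam1984`]
* A. Pazy, *Semigroups of Linear Operators and Applications to PDE* (Springer 1983), Ch. 5 §5.1 Def. 5.3 (evolution systems). [`Pazy1983`]
-/

noncomputable section

open MeasureTheory Set Filter Function TopologicalSpace Complex UnitAddTorus
open scoped ENNReal NNReal InnerProductSpace Topology ComplexConjugate

namespace Literature.Analysis.FluidPDE

namespace Torus

variable {d : Type*} [Fintype d] [DecidableEq d]

namespace IsPropagator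

variable {T : ℝ} {𝔸 : Visc4 d} {lo hi : ℝ} {b : ℝ → UnitAddTorus d → EuclideanSpace ℝ d}
variable {U : ℝ → ℝ → (Lp (EuclideanSpace ℝ d) 2 (volume : Measure (UnitAddTorus d)) →L[ℝ]
  Lp (EuclideanSpace ℝ d) 2 (volume : Measure (UnitAddTorus d)))}

omit [DecidableEq d] in
/-- The multiplier of a real-weighted family of translations at `−k` is the conjugate of its value at `k`; in particular a REAL level
`m` is missed at `k` iff it is missed at `−k`. [cite: KhaKuchment2021, §1.1] -/
theorem multiplier_neg_ne_of_ne {ι : Type*} [Fintype ι] (g : ι → UnitAddTorus d) (c : ι → ℝ) {m : ℝ} {k : d → ℤ}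
    (hk : (∑ i, (c i : ℂ) * mFourier k (g i)) ≠ m) : (∑ i, (c i : ℂ) * mFourier (-k) (g i)) ≠ m := by
  intro h
  apply hk
  have hconj : (∑ i, (c i : ℂ) * mFourier (-k) (g i)) = conj (∑ i, (c i : ℂ) * mFourier k (g i)) := by
    rw [map_sum]
    refine Finset.sum_congr rfl fun i _ => ?_
    rw [map_mul, Complex.conj_ofReal, mFourier_neg]
  rw [hconj] at h
  have h2 := congrArg conj h
  rwa [Complex.conj_conj, Complex.conj_ofReal] at h2

/-- **BLOCH-SECTOR CONFINEMENT OF THE PROPAGATOR AT EVERY TIME.**  Let `U` be an `IsPropagator T b 𝔸 U` family with `NearIso 𝔸 lo hi`,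
`0 < lo`, an essentially bounded, a.e. weakly divergence-free carrier invariant under finitely many translations `gᵢ`, and real weights `cᵢ`
whose multiplier `ĉ(k) = Σᵢ cᵢ e_k(gᵢ)` takes ONE nonzero real value `m` on the Fourier support of `y ∈ L²`.  Then for all `0 ≤ s ≤ t ≤ T` and
every `k` with `ĉ(k) ≠ m`: `𝓕(U s t y)(k) = 0`. [cite: KhaKuchment2021, §1.1–§1.2] [cite: Temam1984, Ch. III §1 Lemma 1.4] -/
theorem mFourierCoeff_apply_eq_zero_of_multiplier (hU : IsPropagator T b 𝔸 U) (h𝔸 : NearIso 𝔸 lo hi) (hlo : 0 < lo)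
    (hb : MemLp (FunctionSpaces.Torus.stLift b) ∞ (volume.restrict (Ioo 0 T ×ˢ univ)))
    (hbdiv : ∀ᵐ τ ∂(volume.restrict (Ioo 0 T)), FunctionSpaces.Torus.IsWeaklyDivFree (b τ))
    {ι : Type*} [Fintype ι] [Nonempty ι] (g : ι → UnitAddTorus d) (c : ι → ℝ)
    (hper : ∀ i t x, b t (x + g i) = b t x) {m : ℝ} (hm : m ≠ 0)
    (y : Lp (EuclideanSpace ℝ d) 2 (volume : Measure (UnitAddTorus d)))
    (hsupp : ∀ k, mFourierCoeff (FunctionSpaces.EuclideanSpace.complexify ∘ (y : UnitAddTorus d → EuclideanSpace ℝ d)) k ≠ 0 →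
      (∑ i, (c i : ℂ) * mFourier k (g i)) = m)
    {s t : ℝ} (hs : 0 ≤ s) (hst : s ≤ t) (htT : t ≤ T) {k : d → ℤ} (hk : (∑ i, (c i : ℂ) * mFourier k (g i)) ≠ m) :
    mFourierCoeff (FunctionSpaces.EuclideanSpace.complexify ∘
      ((U s t y : Lp (EuclideanSpace ℝ d) 2 volume) : UnitAddTorus d → EuclideanSpace ℝ d)) k = 0 := by
  classical
  -- the Leray projection of the datum and its support
  set P := (divFreeL2 d).starProjection with hP
  set φ : UnitAddTorus d → EuclideanSpace ℝ d := ((P y : Lp (EuclideanSpace ℝ d) 2 volume) : UnitAddTorus d → EuclideanSpace ℝ d)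
    with hφdef
  have hφ : MemLp φ 2 volume := Lp.memLp (P y)
  have hφdiv : FunctionSpaces.Torus.IsWeaklyDivFree φ := isWeaklyDivFree_starProjection y
  have hφoff : ∀ k', (∑ i, (c i : ℂ) * mFourier k' (g i)) ≠ m →
      mFourierCoeff (FunctionSpaces.EuclideanSpace.complexify ∘ φ) k' = 0 := by
    intro k' hk'
    by_contra h0
    have hy0 : mFourierCoeff (FunctionSpaces.EuclideanSpace.complexify ∘ (y : UnitAddTorus d → EuclideanSpace ℝ d)) k' = 0 := by
      by_contra hy
      exact hk' (hsupp k' hy)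
    have hle := norm_mFourierCoeff_starProjection_le y k'
    rw [hy0, norm_zero] at hle
    exact h0 (norm_le_zero_iff.1 hle)
  have hsuppφ : ∀ k', mFourierCoeff (FunctionSpaces.EuclideanSpace.complexify ∘ φ) k' ≠ 0 →
      (∑ i, (c i : ℂ) * mFourier k' (g i)) = m := fun k' hk' => by
    by_contra hne
    exact hk' (hφoff k' hne)
  -- the case `t = s`: `U s s y = P y`
  rcases hst.eq_or_lt with heq | hst'
  · subst heq
    have e : U s s y = P y := by
      rw [hU.apply_eq_apply_starProjection s s y]
      exact hU.self_of_divFree s hs htT (P y) hφdiv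
    rw [e]
    exact hφoff k hk
  have hsT : s < T := hst'.trans_le htT
  set τ : ℝ := t - s with hτdef
  have hτ : 0 < τ := sub_pos.2 hst'
  have hτT : τ ≤ T - s := by rw [hτdef]; linarith
  -- the chosen window solution from `P y`: confined for a.e. window time
  set w := windowSol h𝔸 hlo hb hbdiv hs hsT hφ hφdiv with hwdef
  have hw := windowSol_spec h𝔸 hlo hb hbdiv hs hsT hφ hφdiv
  have hbs := memLp_top_stLift_shift_window (T := T) (b := b) hb hs
  have hconf := hw.ae_mFourierCoeff_eq_zero_of_multiplier' h𝔸 hlo hbs g c (fun i r x => hper i (s + r) x) hφ hm hsuppφ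
  have hrepr := hU.repr s hs hsT φ hφ hφdiv w hw
  have hPy : hφ.toLp φ = P y := Lp.toLp_coeFn (P y) hφ
  have hsub : Ioo 0 τ ⊆ Ioo 0 (T - s) := Ioo_subset_Ioo le_rfl hτT
  -- a.e. `r ∈ (0,τ)`: the coefficients of `U s (s+r) y` vanish off the level set
  have hgood : ∀ᵐ r ∂(volume.restrict (Ioo 0 τ)), ∀ k', (∑ i, (c i : ℂ) * mFourier k' (g i)) ≠ m →
      mFourierCoeff (FunctionSpaces.EuclideanSpace.complexify ∘
        ((U s (s + r) y : Lp (EuclideanSpace ℝ d) 2 volume) : UnitAddTorus d → EuclideanSpace ℝ d)) k' = 0 := by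
    filter_upwards [ae_restrict_of_ae_restrict_of_subset hsub hconf, ae_restrict_of_ae_restrict_of_subset hsub hrepr]
      with r hr hrep k' hk'
    obtain ⟨hrm, hre⟩ := hrep
    rw [hPy, ← hU.apply_eq_apply_starProjection s (s + r) y] at hre
    have hae : ((U s (s + r) y : Lp (EuclideanSpace ℝ d) 2 volume) : UnitAddTorus d → EuclideanSpace ℝ d) =ᵐ[volume] w r := by
      rw [← hre]; exact hrm.coeFn_toLp
    have e2 : mFourierCoeff (FunctionSpaces.EuclideanSpace.complexify ∘
        ((U s (s + r) y : Lp (EuclideanSpace ℝ d) 2 volume) : UnitAddTorus d → EuclideanSpace ℝ d)) k' =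
        mFourierCoeff (FunctionSpaces.EuclideanSpace.complexify ∘ w r) k' :=
      FunctionSpaces.Torus.mFourierCoeff_congr_ae (hae.mono fun ξ hξ => by simp only [Function.comp_apply, hξ]) k'
    rw [e2]
    exact hr k' hk'
  -- weak continuity of the pairings on `[0, τ]`
  have hcont : ∀ z : Lp (EuclideanSpace ℝ d) 2 (volume : Measure (UnitAddTorus d)),
      ContinuousOn (fun r => ⟪U s (s + r) y, z⟫_ℝ) (Icc 0 τ) := by
    intro z
    have hc := hU.continuousOn s hs hsT.le y z
    refine (hc.comp (continuous_const.add continuous_id).continuousOn ?_)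
    intro r hr
    exact ⟨by linarith [hr.1], by rw [hτdef] at hr; linarith [hr.2]⟩
  have hsτ : s + τ = t := by rw [hτdef]; ring
  -- the test: the real trigonometric polynomial carrying the coefficients of `U s t y` at `±k`
  set S₀ : Finset (d → ℤ) := {k, -k} with hS₀
  have hS₀sym : ∀ k' ∈ S₀, -k' ∈ S₀ := by
    intro k' hk'
    rw [hS₀, Finset.mem_insert, Finset.mem_singleton] at hk' ⊢
    rcases hk' with h | h
    · exact Or.inr (by rw [h])
    · exact Or.inl (by rw [h, neg_neg])
  have hS₀off : ∀ k' ∈ S₀, (∑ i, (c i : ℂ) * mFourier k' (g i)) ≠ m := by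
    intro k' hk'
    rw [hS₀, Finset.mem_insert, Finset.mem_singleton] at hk'
    rcases hk' with h | h
    · rw [h]; exact hk
    · rw [h]; exact multiplier_neg_ne_of_ne g c hk
  set u' : UnitAddTorus d → EuclideanSpace ℝ d := ((U s t y : Lp (EuclideanSpace ℝ d) 2 volume) : UnitAddTorus d → EuclideanSpace ℝ d)
    with hu'
  have hu'm : MemLp u' 2 volume := Lp.memLp _
  set cF : (d → ℤ) → EuclideanSpace ℂ d := fun k' => mFourierCoeff (FunctionSpaces.EuclideanSpace.complexify ∘ u') k' with hcF
  have hcsym : FunctionSpaces.Torus.IsConjSymm cF := FunctionSpaces.Torus.isConjSymm_mFourierCoeff (hu'm.integrable one_le_two)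
  have hzm : MemLp (FunctionSpaces.Torus.realTrigPoly S₀ cF) 2 volume := FunctionSpaces.Torus.memLp_realTrigPoly S₀ cF 2
  set z : Lp (EuclideanSpace ℝ d) 2 (volume : Measure (UnitAddTorus d)) := hzm.toLp _ with hz
  -- the pairing `⟪v, z⟫ = Σ_{k'∈S₀} Re⟪𝓕v(k'), cF k'⟫` for `v ∈ L²`
  have hpair : ∀ v : Lp (EuclideanSpace ℝ d) 2 (volume : Measure (UnitAddTorus d)),
      ⟪v, z⟫_ℝ = ∑ k' ∈ S₀, (inner ℂ (mFourierCoeff (FunctionSpaces.EuclideanSpace.complexify ∘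
        (v : UnitAddTorus d → EuclideanSpace ℝ d)) k') (cF k')).re := by
    intro v
    rw [MeasureTheory.L2.inner_def, ← FunctionSpaces.Torus.integral_inner_realTrigPoly_right hS₀sym hcsym (Lp.memLp v)]
    refine integral_congr_ae ?_
    filter_upwards [hzm.coeFn_toLp] with ξ hξ
    rw [hz] ; simp only [hξ]
  -- a.e. on `(0,τ)` the pairing vanishes; by continuity it vanishes at `τ`
  have hfg : ∀ᵐ r ∂(volume.restrict (Ioo 0 τ)), ⟪U s (s + r) y, z⟫_ℝ = 0 := by
    filter_upwards [hgood] with r hr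
    rw [hpair]
    refine Finset.sum_eq_zero fun k' hk' => ?_
    rw [hr k' (hS₀off k' hk'), inner_zero_left, Complex.zero_re]
  have hle : ⟪U s (s + τ) y, z⟫_ℝ ≤ 0 := by
    have h := le_on_Icc_of_ae_le_of_continuousOn₂ (g := fun _ => (0 : ℝ)) hτ (hcont z) continuousOn_const
      (hfg.mono fun r hr => hr.le) τ ⟨hτ.le, le_rfl⟩
    exact h
  have hge : 0 ≤ ⟪U s (s + τ) y, z⟫_ℝ := by
    have hc' : ContinuousOn (fun r => -⟪U s (s + r) y, z⟫_ℝ) (Icc 0 τ) := (hcont z).neg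
    have h := le_on_Icc_of_ae_le_of_continuousOn₂ (g := fun _ => (0 : ℝ)) hτ hc' continuousOn_const
      (hfg.mono fun r hr => by rw [hr, neg_zero]) τ ⟨hτ.le, le_rfl⟩
    have h' : -⟪U s (s + τ) y, z⟫_ℝ ≤ 0 := h
    linarith
  have hzero : ⟪U s (s + τ) y, z⟫_ℝ = 0 := le_antisymm hle hge
  -- at `τ` the pairing is `Σ_{k'∈S₀} ‖cF k'‖²`
  have hfτ : ⟪U s (s + τ) y, z⟫_ℝ = ∑ k' ∈ S₀, ‖cF k'‖ ^ 2 := by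
    rw [hsτ, hpair]
    refine Finset.sum_congr rfl fun k' _ => ?_
    rw [← @inner_self_eq_norm_sq ℂ]
    rfl
  rw [hfτ] at hzero
  have hk0 : ‖cF k‖ ^ 2 = 0 := by
    have hmem : k ∈ S₀ := by rw [hS₀]; exact Finset.mem_insert_self _ _
    have hnn : ∀ k' ∈ S₀, 0 ≤ ‖cF k'‖ ^ 2 := fun k' _ => sq_nonneg _
    exact (Finset.sum_eq_zero_iff_of_nonneg hnn).1 hzero k hmem
  have : cF k = 0 := by
    have h1 : ‖cF k‖ = 0 := pow_eq_zero_iff (two_ne_zero) |>.1 hk0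
    exact norm_eq_zero.1 h1
  exact this

end IsPropagator

end Torus

end Literature.Analysis.FluidPDE

end
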